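import Mathlib
import Literature.NumberTheory.LFunctions.Zhang2022.Section7aStatements
import Literature.NumberTheory.LFunctions.Zhang2022.TypedSection14
import HarnessLib

/-!
# Zhang (2022) §14, (14.3): the tail `Σ_{m>P²} κ*(m)ψ(m)m^{−s}` — summability, splitting, trivial bounds

Topic `Literature/NumberTheory/LFunctions/Zhang2022` (Landau–Siegel adjudication tree; verdict-neutral;
cell siegel-zhang, toward the DAG deduction node `Z22:(14.3)` = `Typed.Sec14.DedEq143`).
Y. Zhang, *Discrete mean estimates and the Landau–Siegel zero*, arXiv:2211.02515v1 (2022)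
[Zhang2022LandauSiegel] — **an unrefereed manuscript under adjudication; nothing here bears on its
Theorems 1–2 or on Landau–Siegel zeros.** §14 p. 76 proves (14.3) "similar to the proof of
Proposition 7.1", i.e. by §7 p. 34 (tex L1877–L1882): "we split the sum over `m` according to
`m < P²` and `m ≥ P²`. To handle the second one we appeal to the trivial bounds
`Σ_{m≥P²} … ≪ P^{2(1−σ)}𝓛ᶜ`, `A(…) ≪ (PT⁻²)^σ` for `σ ≥ 3/2`".

This file PROVES the (14.3) versions of these preliminaries (theorems only; no new definition, no
named fact), for `κ*` with `|κ*(m)| ≤ Bτ₅(m)` ((14.1) = `Typed.Sec14.Eq141`) and `|a*(n)| ≤ B`: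
* `summable_tau_five_rpow` — `Σ_m τ₅(m)m^{−σ} < ∞` for `σ > 1` (the series is `ζ(σ)⁵`; after
  L2-t2's private `Section7aStatements.LSeries_zeta_pow`);
* `summable_twist`, `tsum_twist_eq_head_add_LSeries` — for `Re s > 1` the series
  `Σ_m κ*(m)ψ(m)m^{−s}` of `Typed.Sec14.i2Tilde` converges absolutely and splits as the head
  `Σ_{1≤m≤X}` plus the `LSeries` of the tail sequence `m ↦ [X < m]κ*(m)ψ(m)`;
* `differentiableOn_LSeries_tail` — that `LSeries` is holomorphic on `Re s > 1`;
* `norm_LSeries_tail_le` — the Rankin-type bound `|Σ_{m>X} κ*(m)ψ(m)m^{−s}| ≤ B·S·(X+1)^{5/4−σ}`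
  for `σ ≥ 5/4` (`S = Σ τ₅(m)m^{−5/4}`, an absolute constant);
* `norm_apoly_le_pow` — `|Σ_{n≤N} a*(n)ψ̄(n)n^{s−1}| ≤ B·N^σ` for `σ ≥ 1` (`N = ⌊2P₄⌋`);
* `four_D_t0_sq_le_bigT` — `4Dt₀² ≤ T` eventually (so the base `Dpt₀N/P² ≤ 4Dt₀²T⁻² ≤ T⁻¹`).

## References

* Y. Zhang, arXiv:2211.02515v1 (2022), §14 (14.3) p. 76; §7 p. 34, tex L1877–L1882.
  [cite: Zhang2022LandauSiegel, §14 (14.3) p. 76; §7 p. 34]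
-/

noncomputable section

open Complex Real
open scoped ComplexConjugate

namespace Literature.NumberTheory.LFunctions.Zhang2022.Typed.Sec14.Eq143

open Skeleton MeanSquareMajorant

/-! ### `Σ τ₅(m) m^{−σ}` converges for `σ > 1` -/

/-- The complex sequence `n ↦ (ζ n : ℂ)` of the coerced arithmetic function is Mathlib's `↗ζ`. [folklore] -/
private theorem zetaC_apply (n : ℕ) :
    (ArithmeticFunction.zeta : ArithmeticFunction ℂ) n = ((ArithmeticFunction.zeta n : ℕ) : ℂ) :=
  ArithmeticFunction.natCoe_apply

/-- `Σ ζ^{∗(k+1)}(n) n^{−s}` is `LSeries`-summable for `Re s > 1`. [folklore] -/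
private theorem LSeriesSummable_zeta_pow {s : ℂ} (hs : 1 < s.re) (k : ℕ) :
    LSeriesSummable (fun n => ((ArithmeticFunction.zeta : ArithmeticFunction ℂ) ^ (k + 1)) n) s := by
  have hζ : LSeriesSummable (fun n => (ArithmeticFunction.zeta : ArithmeticFunction ℂ) n) s := by
    simp_rw [zetaC_apply]; exact ArithmeticFunction.LSeriesSummable_zeta_iff.mpr hs
  induction k with
  | zero => simpa [pow_one] using hζ
  | succ k ih => rw [pow_succ]; exact ArithmeticFunction.LSeriesSummable_mul ih hζ

/-- `τ₅` in the shape of (14.1) is the tree's `MeanSquareMajorant.tau 5`. [folklore] -/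
private theorem tau_five_eq' (n : ℕ) : (((ArithmeticFunction.zeta ^ 5 : ArithmeticFunction ℕ)) n : ℝ) =
    tau 5 n := by
  have h : ∀ i : ℕ, ((ArithmeticFunction.zeta ^ i : ArithmeticFunction ℕ) : ArithmeticFunction ℝ) =
      (ArithmeticFunction.zeta : ArithmeticFunction ℝ) ^ i := by
    intro i
    induction i with
    | zero => rw [pow_zero, pow_zero, ArithmeticFunction.natCoe_one]
    | succ i ih => rw [pow_succ, pow_succ, ArithmeticFunction.natCoe_mul, ih]
  rw [tau, ← h, ArithmeticFunction.natCoe_apply]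

/-- **`Σ_m τ₅(m)m^{−σ} < ∞` for real `σ > 1`** (the series is `ζ(σ)⁵`).
[cite: Zhang2022LandauSiegel, §7 p. 34, tex L1878] -/
theorem summable_tau_five_rpow {σ : ℝ} (h : 1 < σ) :
    Summable fun m : ℕ => tau 5 m * (m : ℝ) ^ (-σ) := by
  have hs : 1 < (σ : ℂ).re := by simpa using h
  have hS := LSeriesSummable_zeta_pow hs 4
  have hterm : ∀ m : ℕ, ((tau 5 m * (m : ℝ) ^ (-σ) : ℝ) : ℂ) =
      LSeries.term (fun n => ((ArithmeticFunction.zeta : ArithmeticFunction ℂ) ^ (4 + 1)) n) (σ : ℂ) m := by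
    intro m
    rcases Nat.eq_zero_or_pos m with rfl | hm
    · rw [LSeries.term_zero, Nat.cast_zero, Real.zero_rpow (neg_ne_zero.mpr (by linarith : σ ≠ 0)),
        mul_zero, Complex.ofReal_zero]
    · rw [LSeries.term_of_ne_zero hm.ne', ← tau_ofReal_eq_pow_apply, Complex.ofReal_mul,
        Complex.ofReal_cpow (Nat.cast_nonneg m), Complex.ofReal_natCast, Complex.ofReal_neg,
        Complex.cpow_neg, div_eq_mul_inv]
  have hsumC : Summable fun m : ℕ => ((tau 5 m * (m : ℝ) ^ (-σ) : ℝ) : ℂ) := by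
    simp_rw [hterm]; exact hS
  exact Complex.summable_ofReal.mp hsumC

/-! ### The twisted series `Σ_m κ*(m)ψ(m)m^{−s}` and its tail as an `LSeries` -/

/-- Termwise bound: `|κ*(m)ψ(m)m^{−s}| ≤ Bτ₅(m)m^{−σ}`. [cite: Zhang2022LandauSiegel, §14 (14.1) p. 76] -/
theorem norm_twist_term_le {D : ℕ} (x : Chr D) {B : ℝ} {κs : ℕ → ℂ} (hκ : Eq141 B κs)
    (s : ℂ) (m : ℕ) :
    ‖κs m * x.ψ (m : ZMod x.p) * (m : ℂ) ^ (-s)‖ ≤ B * (tau 5 m * (m : ℝ) ^ (-s.re)) := by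
  have hB : 0 ≤ B := by
    have h := hκ 1
    rw [tau_five_eq', tau_apply_one, mul_one] at h
    exact (norm_nonneg _).trans h
  rcases Nat.eq_zero_or_pos m with rfl | hm
  · have h0 : x.ψ ((0 : ℕ) : ZMod x.p) = 0 := by rw [Nat.cast_zero, MulChar.map_zero]
    rw [h0, mul_zero, zero_mul, norm_zero]
    exact mul_nonneg hB (mul_nonneg (tau_nonneg 5 0) (Real.rpow_nonneg (Nat.cast_nonneg 0) _))
  · rw [norm_mul, norm_mul, Complex.norm_natCast_cpow_of_pos hm, Complex.neg_re]
    have h1 : ‖κs m‖ ≤ B * tau 5 m := by rw [← tau_five_eq']; exact hκ m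
    have h2 : ‖x.ψ (m : ZMod x.p)‖ ≤ 1 := DirichletCharacter.norm_le_one _ _
    calc ‖κs m‖ * ‖x.ψ (m : ZMod x.p)‖ * (m : ℝ) ^ (-s.re) ≤ B * tau 5 m * 1 * (m : ℝ) ^ (-s.re) := by
          gcongr
          · exact mul_nonneg hB (tau_nonneg 5 m)
      _ = B * (tau 5 m * (m : ℝ) ^ (-s.re)) := by ring

/-- **Absolute convergence for `Re s > 1`** of `Σ_m κ*(m)ψ(m)m^{−s}` (the series inside `Ĩ₂`, which
is used on `𝔍(1)`, `σ = 3/2`). [cite: Zhang2022LandauSiegel, §14 p. 76 (definition of `Ĩ₂`)] -/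
theorem summable_twist {D : ℕ} (x : Chr D) {B : ℝ} {κs : ℕ → ℂ} (hκ : Eq141 B κs) {s : ℂ}
    (hs : 1 < s.re) : Summable fun m : ℕ => κs m * x.ψ (m : ZMod x.p) * (m : ℂ) ^ (-s) :=
  Summable.of_norm_bounded ((summable_tau_five_rpow hs).mul_left B) (norm_twist_term_le x hκ s)

/-- The `LSeries` terms of the tail sequence `m ↦ [X < m]κ*(m)ψ(m)` are the terms `m > X` of the
twisted series ("the sum over `m ≥ P²`", §7 p. 34). [cite: Zhang2022LandauSiegel, §7 p. 34, tex L1877] -/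
theorem term_tail_eq {D : ℕ} (x : Chr D) (κs : ℕ → ℂ) (X : ℕ) (s : ℂ) (m : ℕ) :
    LSeries.term (fun m : ℕ => if X < m then κs m * x.ψ (m : ZMod x.p) else 0) s m =
      if X < m then κs m * x.ψ (m : ZMod x.p) * (m : ℂ) ^ (-s) else 0 := by
  rcases Nat.eq_zero_or_pos m with rfl | hm
  · rw [LSeries.term_zero, if_neg (Nat.not_lt_zero X)]
  · rw [LSeries.term_of_ne_zero hm.ne']
    split_ifs
    · rw [Complex.cpow_neg, div_eq_mul_inv]
    · rw [zero_div]

/-- The tail sequence is `LSeries`-summable for `Re s > 1`. [cite: Zhang2022LandauSiegel, §7 p. 34, tex L1878] -/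
theorem LSeriesSummable_tail {D : ℕ} (x : Chr D) {B : ℝ} {κs : ℕ → ℂ} (hκ : Eq141 B κs) (X : ℕ)
    {s : ℂ} (hs : 1 < s.re) :
    LSeriesSummable (fun m : ℕ => if X < m then κs m * x.ψ (m : ZMod x.p) else 0) s := by
  unfold LSeriesSummable
  rw [show LSeries.term (fun m : ℕ => if X < m then κs m * x.ψ (m : ZMod x.p) else 0) s =
      fun m => if X < m then κs m * x.ψ (m : ZMod x.p) * (m : ℂ) ^ (-s) else 0 from
    funext (term_tail_eq x κs X s)]
  refine Summable.of_norm_bounded ((summable_tau_five_rpow hs).mul_left B) fun m => ?_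
  split_ifs
  · exact norm_twist_term_le x hκ s m
  · rw [norm_zero]
    exact le_trans (norm_nonneg _) (norm_twist_term_le x hκ s m)

/-- **Splitting at `X`** ("we split the sum over `m` according to `m < P²` and `m ≥ P²`", §7 p. 34):
for `Re s > 1`, `Σ_m κ*(m)ψ(m)m^{−s} = Σ_{1≤m≤X} κ*(m)ψ(m)m^{−s} + Σ_{m>X} κ*(m)ψ(m)m^{−s}`, the tail
written as the `LSeries` of `m ↦ [X < m]κ*(m)ψ(m)` (`ψ(0) = 0` disposes of `m = 0`).
[cite: Zhang2022LandauSiegel, §7 p. 34, tex L1877; §14 (14.3) p. 76] -/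
theorem tsum_twist_eq_head_add_LSeries {D : ℕ} (x : Chr D) {B : ℝ} {κs : ℕ → ℂ}
    (hκ : Eq141 B κs) (X : ℕ) {s : ℂ} (hs : 1 < s.re) :
    ∑' m : ℕ, κs m * x.ψ (m : ZMod x.p) * (m : ℂ) ^ (-s) =
      ∑ m ∈ Finset.Icc 1 X, κs m * x.ψ (m : ZMod x.p) * (m : ℂ) ^ (-s) +
        LSeries (fun m : ℕ => if X < m then κs m * x.ψ (m : ZMod x.p) else 0) s := by
  set f : ℕ → ℂ := fun m => κs m * x.ψ (m : ZMod x.p) * (m : ℂ) ^ (-s) with hf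
  have hsum : Summable f := summable_twist x hκ hs
  have hsplit : ∀ m, f m = (if m ≤ X then f m else 0) + (if X < m then f m else 0) := by
    intro m
    by_cases h : m ≤ X
    · rw [if_pos h, if_neg (not_lt.mpr h), add_zero]
    · rw [if_neg h, if_pos (not_le.mp h), zero_add]
  have h1 : Summable fun m => if m ≤ X then f m else 0 := by
    refine summable_of_ne_finset_zero (s := Finset.range (X + 1)) fun m hm => ?_
    rw [Finset.mem_range, not_lt] at hm
    exact if_neg (by omega)
  have h2 : Summable fun m => if X < m then f m else 0 := by
    have := (LSeriesSummable_tail x hκ X hs)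
    unfold LSeriesSummable at this
    rwa [show LSeries.term (fun m : ℕ => if X < m then κs m * x.ψ (m : ZMod x.p) else 0) s =
        fun m => if X < m then κs m * x.ψ (m : ZMod x.p) * (m : ℂ) ^ (-s) else 0 from
      funext (term_tail_eq x κs X s)] at this
  have hf0 : f 0 = 0 := by
    rw [hf]; simp only [Nat.cast_zero, MulChar.map_zero, mul_zero, zero_mul]
  rw [LSeries]
  simp_rw [term_tail_eq]
  calc ∑' m, f m = ∑' m, ((if m ≤ X then f m else 0) + (if X < m then f m else 0)) :=
        tsum_congr hsplit
    _ = ∑' m, (if m ≤ X then f m else 0) + ∑' m, (if X < m then f m else 0) := h1.tsum_add h2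
    _ = ∑ m ∈ Finset.Icc 1 X, f m + ∑' m, (if X < m then f m else 0) := by
        congr 1
        rw [tsum_eq_sum (s := Finset.range (X + 1)) fun m hm => by
          rw [Finset.mem_range, not_lt] at hm; exact if_neg (by omega)]
        rw [Finset.sum_congr rfl fun m hm => if_pos (by
          have := Finset.mem_range.mp hm; omega), Finset.range_eq_Ico]
        have e : Finset.Ico 0 (X + 1) = insert 0 (Finset.Icc 1 X) := by
          ext m; simp only [Finset.mem_Ico, Finset.mem_insert, Finset.mem_Icc]; omega
        rw [e, Finset.sum_insert (by simp)]
        simp only [hf] at hf0 ⊢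
        rw [hf0, zero_add]

/-- **The tail `LSeries` is holomorphic on `Re s > 1`** (its abscissa of absolute convergence is
`≤ 1`). [cite: Zhang2022LandauSiegel, §7 p. 35, tex L1890 ("moving the segment")] -/
theorem differentiableOn_LSeries_tail {D : ℕ} (x : Chr D) {B : ℝ} {κs : ℕ → ℂ} (hκ : Eq141 B κs)
    (X : ℕ) :
    DifferentiableOn ℂ (LSeries fun m : ℕ => if X < m then κs m * x.ψ (m : ZMod x.p) else 0)
      {s : ℂ | 1 < s.re} := by
  have habs : LSeries.abscissaOfAbsConv
      (fun m : ℕ => if X < m then κs m * x.ψ (m : ZMod x.p) else 0) ≤ (1 : ℝ) :=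
    LSeries.abscissaOfAbsConv_le_of_forall_lt_LSeriesSummable fun y hy =>
      LSeriesSummable_tail x hκ X (by simpa using hy)
  refine (LSeries_differentiableOn _).mono fun s hs => ?_
  exact lt_of_le_of_lt habs (by exact_mod_cast hs)

/-! ### The trivial bounds for `σ ≥ 5/4` -/

/-- **Rankin-type bound for the tail** ("`Σ_{m≥P²} … ≪ P^{2(1−σ)}𝓛ᶜ`", §7 p. 34, here with the
fixed comparison exponent `σ₀ = 5/4`): there is an absolute `S ≥ 0` (`= Σ τ₅(m)m^{−5/4}`) with
`|Σ_{m>X} κ*(m)ψ(m)m^{−s}| ≤ B·S·(X+1)^{5/4−σ}` for `σ ≥ 5/4`, `|κ*| ≤ Bτ₅`.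
[cite: Zhang2022LandauSiegel, §7 p. 34, tex L1878; §14 (14.3) p. 76] -/
theorem norm_LSeries_tail_le : ∃ S : ℝ, 0 ≤ S ∧ ∀ {D : ℕ} (x : Chr D) {B : ℝ} {κs : ℕ → ℂ},
    Eq141 B κs → ∀ (X : ℕ) (s : ℂ), 5 / 4 ≤ s.re →
      ‖LSeries (fun m : ℕ => if X < m then κs m * x.ψ (m : ZMod x.p) else 0) s‖ ≤
        B * S * ((X : ℝ) + 1) ^ (5 / 4 - s.re) := by
  have hsum := summable_tau_five_rpow (σ := 5 / 4) (by norm_num)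
  set S : ℝ := ∑' m : ℕ, tau 5 m * (m : ℝ) ^ (-(5 / 4 : ℝ)) with hSdef
  have hS0 : 0 ≤ S :=
    tsum_nonneg fun m => mul_nonneg (tau_nonneg 5 m) (Real.rpow_nonneg (Nat.cast_nonneg m) _)
  refine ⟨S, hS0, fun x B κs hκ X s hs => ?_⟩
  have hB : 0 ≤ B := by
    have h := hκ 1
    rw [tau_five_eq', tau_apply_one, mul_one] at h
    exact (norm_nonneg _).trans h
  set σ := s.re with hσ
  set Y : ℝ := (X : ℝ) + 1 with hY
  have hY0 : 0 < Y := by positivity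
  set g : ℕ → ℝ := fun m => B * Y ^ (5 / 4 - σ) * (tau 5 m * (m : ℝ) ^ (-(5 / 4 : ℝ))) with hg
  have hg_summ : Summable g := hsum.mul_left _
  have hK0 : 0 ≤ B * Y ^ (5 / 4 - σ) := mul_nonneg hB (Real.rpow_nonneg hY0.le _)
  have hg0 : ∀ m, 0 ≤ g m := fun m =>
    mul_nonneg hK0 (mul_nonneg (tau_nonneg 5 m) (Real.rpow_nonneg (Nat.cast_nonneg m) _))
  have hf : ∀ m : ℕ, ‖(if X < m then κs m * x.ψ (m : ZMod x.p) * (m : ℂ) ^ (-s) else 0)‖ ≤ g m := by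
    intro m
    split_ifs with hm
    · have hm0 : 0 < m := by omega
      have hmY : Y ≤ m := by rw [hY]; exact_mod_cast hm
      have hm0' : (0 : ℝ) < m := by exact_mod_cast hm0
      refine (norm_twist_term_le x hκ s m).trans ?_
      rw [hg, ← hσ]
      have h2 : (m : ℝ) ^ (-σ) ≤ Y ^ (5 / 4 - σ) * (m : ℝ) ^ (-(5 / 4 : ℝ)) := by
        rw [show -σ = -(σ - 5 / 4) + -(5 / 4 : ℝ) by ring, Real.rpow_add hm0',
          show (5 / 4 : ℝ) - σ = -(σ - 5 / 4) by ring]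
        exact mul_le_mul_of_nonneg_right
          (Real.rpow_le_rpow_of_nonpos hY0 hmY (by linarith)) (Real.rpow_nonneg hm0'.le _)
      calc B * (tau 5 m * (m : ℝ) ^ (-σ)) = B * tau 5 m * (m : ℝ) ^ (-σ) := by ring
        _ ≤ B * tau 5 m * (Y ^ (5 / 4 - σ) * (m : ℝ) ^ (-(5 / 4 : ℝ))) :=
            mul_le_mul_of_nonneg_left h2 (mul_nonneg hB (tau_nonneg 5 m))
        _ = B * Y ^ (5 / 4 - σ) * (tau 5 m * (m : ℝ) ^ (-(5 / 4 : ℝ))) := by ring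
    · rw [norm_zero]; exact hg0 m
  have hsumm : Summable fun m : ℕ =>
      ‖(if X < m then κs m * x.ψ (m : ZMod x.p) * (m : ℂ) ^ (-s) else 0)‖ :=
    Summable.of_nonneg_of_le (fun _ => norm_nonneg _) hf hg_summ
  rw [LSeries]
  simp_rw [term_tail_eq]
  calc ‖∑' m : ℕ, (if X < m then κs m * x.ψ (m : ZMod x.p) * (m : ℂ) ^ (-s) else 0)‖
      ≤ ∑' m : ℕ, ‖(if X < m then κs m * x.ψ (m : ZMod x.p) * (m : ℂ) ^ (-s) else 0)‖ :=
        norm_tsum_le_tsum_norm hsumm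
    _ ≤ ∑' m : ℕ, g m := Summable.tsum_le_tsum hf hsumm hg_summ
    _ = B * Y ^ (5 / 4 - σ) * S := by rw [hSdef, ← tsum_mul_left]
    _ = B * S * Y ^ (5 / 4 - σ) := by ring

/-- **The trivial bound for the `a*`-polynomial on `σ ≥ 1`** (the (14.3) twin of "`A(…) ≪ (PT⁻²)^σ`",
§7 p. 34): `|Σ_{n≤⌊2P₄⌋} a*(n)ψ̄(n)n^{s−1}| ≤ B·⌊2P₄⌋^σ` (`|n^{s−1}| = n^{σ−1} ≤ N^{σ−1}`, `N` terms).
[cite: Zhang2022LandauSiegel, §7 p. 34, tex L1878; §14 (14.2) p. 76] -/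
theorem norm_apoly_le_pow {D : ℕ} (x : Chr D) {B : ℝ} {as : ℕ → ℂ} (ha : ∀ n, ‖as n‖ ≤ B)
    {s : ℂ} (hs : 1 ≤ s.re) :
    ‖∑ n ∈ Finset.Icc 1 ⌊2 * P4 D⌋₊, as n * conj (x.ψ (n : ZMod x.p)) * (n : ℂ) ^ (s - 1)‖ ≤
      B * (⌊2 * P4 D⌋₊ : ℝ) ^ s.re := by
  set N : ℕ := ⌊2 * P4 D⌋₊ with hN
  have hB : 0 ≤ B := (norm_nonneg _).trans (ha 0)
  rcases Nat.eq_zero_or_pos N with hN0 | hN0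
  · rw [hN0, show Finset.Icc 1 0 = ∅ by rfl, Finset.sum_empty, norm_zero, Nat.cast_zero,
      Real.zero_rpow (by linarith), mul_zero]
  have hN0' : (0 : ℝ) < N := by exact_mod_cast hN0
  calc ‖∑ n ∈ Finset.Icc 1 N, as n * conj (x.ψ (n : ZMod x.p)) * (n : ℂ) ^ (s - 1)‖
      ≤ ∑ n ∈ Finset.Icc 1 N, ‖as n * conj (x.ψ (n : ZMod x.p)) * (n : ℂ) ^ (s - 1)‖ := norm_sum_le _ _
    _ ≤ ∑ n ∈ Finset.Icc 1 N, B * (N : ℝ) ^ (s.re - 1) := by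
        refine Finset.sum_le_sum fun n hn => ?_
        have hn1 : 1 ≤ n := (Finset.mem_Icc.mp hn).1
        have hnN : n ≤ N := (Finset.mem_Icc.mp hn).2
        rw [norm_mul, norm_mul, Complex.norm_conj]
        have h2 : ‖x.ψ (n : ZMod x.p)‖ ≤ 1 := DirichletCharacter.norm_le_one _ _
        have h3 : ‖(n : ℂ) ^ (s - 1)‖ ≤ (N : ℝ) ^ (s.re - 1) := by
          rw [Complex.norm_natCast_cpow_of_pos hn1, Complex.sub_re, Complex.one_re]
          exact Real.rpow_le_rpow (Nat.cast_nonneg n) (by exact_mod_cast hnN) (by linarith)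
        calc ‖as n‖ * ‖x.ψ (n : ZMod x.p)‖ * ‖(n : ℂ) ^ (s - 1)‖ ≤ B * 1 * (N : ℝ) ^ (s.re - 1) :=
              mul_le_mul (mul_le_mul (ha n) h2 (norm_nonneg _) hB) h3 (norm_nonneg _)
                (by rw [mul_one]; exact hB)
          _ = B * (N : ℝ) ^ (s.re - 1) := by rw [mul_one]
    _ = (N : ℝ) * (B * (N : ℝ) ^ (s.re - 1)) := by
        rw [Finset.sum_const, Nat.card_Icc, nsmul_eq_mul]; simp
    _ = B * ((N : ℝ) ^ (s.re - 1) * (N : ℝ) ^ (1 : ℝ)) := by rw [Real.rpow_one]; ring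
    _ = B * (N : ℝ) ^ s.re := by rw [← Real.rpow_add hN0']; ring_nf

/-! ### `4Dt₀² ≤ T` eventually -/

/-- **`4Dt₀² ≤ T` for all large `D`** (`D = e^{𝓛}`, `t₀ = 𝓛⁵¹⁹`, `T = e^{𝓛^{1.1}}`): for
`𝓛 ≥ 1024` one has `𝓛^{0.1} ≥ 2`, so `𝓛^{1.1} ≥ 2𝓛` and `T ≥ D²`, while `4𝓛¹⁰³⁸ ≤ D` once
`𝓛 ≥ 4·1039!`. [cite: Zhang2022LandauSiegel, §2 p. 4–5 (the parameters `P`, `T`, `t₀`)] -/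
theorem four_D_t0_sq_le_bigT : ∃ D₀ : ℕ, ∀ D : ℕ, D₀ ≤ D → 4 * (D : ℝ) * t0 D ^ 2 ≤ bigT D := by
  obtain ⟨D₀, hD₀⟩ := exists_nat_forall_le_ell (max 1024 (4 * (Nat.factorial 1039 : ℝ)))
  refine ⟨max 1 D₀, fun D hD => ?_⟩
  have hD1 : 1 ≤ D := le_trans (le_max_left _ _) hD
  have hℓ := hD₀ D (le_trans (le_max_right _ _) hD)
  have hℓ1024 : (1024 : ℝ) ≤ ell D := le_trans (le_max_left _ _) hℓ
  have hℓfac : 4 * (Nat.factorial 1039 : ℝ) ≤ ell D := le_trans (le_max_right _ _) hℓ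
  have hℓ1 : 1 ≤ ell D := by linarith
  have hℓ0 : 0 < ell D := by linarith
  have hDexp : (D : ℝ) = Real.exp (ell D) := by
    rw [ell, Real.exp_log (by exact_mod_cast hD1)]
  -- `𝓛^{0.1} ≥ 2`, hence `𝓛^{1.1} ≥ 2𝓛`
  have h01 : (2 : ℝ) ≤ ell D ^ (0.1 : ℝ) := by
    have h2 : (2 : ℝ) = (1024 : ℝ) ^ (0.1 : ℝ) := by
      rw [show (1024 : ℝ) = 2 ^ (10 : ℝ) by norm_num, ← Real.rpow_mul (by norm_num)]
      norm_num
    rw [h2]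
    exact Real.rpow_le_rpow (by norm_num) hℓ1024 (by norm_num)
  have h11 : 2 * ell D ≤ ell D ^ (1.1 : ℝ) := by
    rw [show (1.1 : ℝ) = 1 + 0.1 by norm_num, Real.rpow_add hℓ0, Real.rpow_one]
    nlinarith
  have hT : Real.exp (ell D) * Real.exp (ell D) ≤ bigT D := by
    rw [bigT, ← Real.exp_add]
    exact Real.exp_le_exp.mpr (by linarith)
  -- `4𝓛¹⁰³⁸ ≤ e^{𝓛}`
  have h1038 : 4 * ell D ^ 1038 ≤ Real.exp (ell D) := by
    have h1 : ell D ^ 1039 ≤ (Nat.factorial 1039 : ℝ) * Real.exp (ell D) := by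
      have := Real.pow_div_factorial_le_exp (ell D) hℓ0.le 1039
      rwa [div_le_iff₀ (by exact_mod_cast Nat.factorial_pos _), mul_comm] at this
    have h2 : 4 * ell D ^ 1038 * ell D ≤ Real.exp (ell D) * ell D := by
      calc 4 * ell D ^ 1038 * ell D = 4 * ell D ^ 1039 := by ring
        _ ≤ 4 * ((Nat.factorial 1039 : ℝ) * Real.exp (ell D)) := by linarith
        _ = (4 * (Nat.factorial 1039 : ℝ)) * Real.exp (ell D) := by ring
        _ ≤ ell D * Real.exp (ell D) := mul_le_mul_of_nonneg_right hℓfac (Real.exp_pos _).le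
        _ = Real.exp (ell D) * ell D := mul_comm _ _
    exact le_of_mul_le_mul_right h2 hℓ0
  calc 4 * (D : ℝ) * t0 D ^ 2 = (4 * ell D ^ 1038) * (D : ℝ) := by rw [t0]; ring
    _ ≤ Real.exp (ell D) * Real.exp (ell D) := by
        rw [hDexp]
        exact mul_le_mul_of_nonneg_right h1038 (Real.exp_pos _).le
    _ ≤ bigT D := hT

end Literature.NumberTheory.LFunctions.Zhang2022.Typed.Sec14.Eq143

end
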